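import Summits.BirchSwinnertonDyer.BirchSwinnertonDyer.Theorems.AdditiveBranchIMCGordTwoRankOneHeegnerKolyvaginStepL
import Summits.BirchSwinnertonDyer.BirchSwinnertonDyer.Theorems.AdditiveBranchIMCGordTwoRankOneHeegnerKolyvaginNecessity
import Literature.NumberTheory.EllipticCurves.HeegnerHypothesisKroneckerProofs
import Literature.NumberTheory.EllipticCurves.ComplexMultiplicationBurungaleFlachCorOneProofs
import Literature.NumberTheory.EllipticCurves.QuadraticTwistRank
import Literature.NumberTheory.EllipticCurves.MordellWeilRankZeroProofs
import Literature.NumberTheory.EllipticCurves.MordellWeilTheoremProofs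
import HarnessLib

/-!
# Route `AdditiveBranchIMC` (rung K1), crux `GordTwoRankOne` (item 19358): the Heegner–Kolyvagin road,
# Part 12 — the registered support item `AdjustedHeegnerIndexBoundTowerSurj` (stmt-20498 = STEP L′)
# consumed and produced BY NAME (cell `bsd-addord`, lane `bsd-addord-k1-c3x`, gen 2; `--supports` only)

HONEST FRAMING. THEOREMS ONLY: no definition, no new named fact, no `sorry`; nothing is booked; the crux
19358 and the support item 20498 stay OPEN; «BSD is not proved by any of this». The planner (g23, route
rev 12, 2026-08-27) registered lane B's residual STEP L′ verbatim as the route decl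
`Theses.AdditiveBranchIMC.AdjustedHeegnerIndexBoundTowerSurj` (item stmt-BirchSwinnertonDyer-20498,
support, rank 9): for every rank-one tower-surjective row `(W, p)` of cell (G-ord, `e = 2`), every
imaginary quadratic Heegner field `K` of the conductor, every parametrisation datum `Dt`, Heegner datum `H`,
embedding `ι`, point `P ↦` the Heegner point, every globally minimal model `Wd` of `E^{d_K}`, granted
`Ш(E/K)` finite: `2·ord_p[E(K):ℤP] ≤ ord_p #Ш(E/K) + ord_p ∏c(E) + ord_p ∏c(Wd) + 2·ord_p c(Dt)`.
This file re-points lane B's theorems to that decl, in BOTH directions: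

* §22–§23 bookkeeping for the item's two extra corners (it quantifies over ALL Heegner fields, with no
  `L(E^{d_K},1) ≠ 0` and no `p ∤ #𝓞_K^×` proviso): `not_dvd_unitsTorsionOrder_of_heegner` — an odd prime
  `p ∣ N` never divides `#(𝓞_K^×)_tors` for a Heegner field `K` of `N` (an odd `p ∣ w_K` forces `p = 3` and
  `d_K = −3` by the degree of `Φ_p`, but `3 ∣ N` splits in `K`, so `3 ∤ d_K`); and when `L(E^{d_K},1) = 0`
  the Heegner point is TORSION (Gross–Zagier, `L′(E/K,1) = L′(E,1)·L(E^{d_K},1) = 0`) inside the infinite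
  group `E(K) ⊇ E(ℚ)` of rank `≥ 1`, so `[E(K):ℤP] = 0` in Mathlib's convention and the inequality is
  trivial (`index_zmultiples_eq_zero_of_isOfFinAddOrder`).
* §24 ITEM ⟹ CRUX: `gordTwoRankOne_of_item_of_rest` (= the planner's `RepointCheck2`: PUB + item 20498 +
  the displayed rest ⟹ `GordTwoRankOne`) and the (ii)-rows statement
  `cellGordTwo_missingLowerBoundAt_rankOne_of_towerSurj_of_item` (the Serre-keyed and the `BSDp` forms,
  which need Parts 10/11, follow in Part 13).
* §25 CRUX ⟹ ITEM (no free lunch BY NAME): `adjustedHeegnerIndexBoundTowerSurj_of_gordTwoRankOne_of_twistLower`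
  — `GordTwoRankOne` (hypothesis) + `Typed.MissingLowerBoundAt Wd p` at the Heegner-field twists with
  `L(E^{d_K},1) ≠ 0` (crux 19357's conclusion there) + PUB (`hGZ`, `hKo`, `hGZK`, `hmod`) ⟹ item 20498.

So, modulo PUBLISHED facts: 20498 ∧ LLT(CM) ∧ rest ⟹ 19358, and 19358 ∧ 19357-at-the-twists ⟹ 20498.

References: [JetchevSkinnerWan2017] §7.4.1–§7.4.3; [GrossZagier1986] I.(6.3), V.§2; [Gross1991] (1.1);
[SerreAbelianLadic1968] IV-23; [Cox2013] §7.A; [Miller2011LMS] Def. 1.1.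
-/

set_option autoImplicit false
set_option linter.dupNamespace false
noncomputable section

open scoped Classical NumberField
open WeierstrassCurve NumberField IsDedekindDomain Polynomial
  Literature.NumberTheory.EllipticCurves Literature.NumberTheory.EllipticCurves.ModularForms
  Literature.NumberTheory.EllipticCurves.Rank1Residual
  Literature.NumberTheory.EllipticCurves.Rank1Residual.Typed
  Summit.BirchSwinnertonDyer.Rank1Residual
  Summit.BirchSwinnertonDyer.Rank1Residual.Additive
  Summit.BirchSwinnertonDyer.Rank1Residual.X11b
  Summit.BirchSwinnertonDyer.Rank1Residual.GaloisImage
  Literature.NumberTheory.Automorphic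
  Summit.BirchSwinnertonDyer.BirchSwinnertonDyer.Theses.AdditiveBranchIMC

namespace Summit.BirchSwinnertonDyer.BirchSwinnertonDyer.Theorems.AdditiveBranchIMCGordTwoRankOne.HeegnerKolyvagin

/-! ### §22 Units of a Heegner field: an odd `p ∣ N` is prime to `#(𝓞_K^×)_tors` -/

/-- **An odd prime dividing `#(𝓞_K^×)_tors` of a quadratic field is `3`, and then `d_K = −3`.** If
`p ∣ w_K` there is a unit of order `p` (Cauchy), i.e. a primitive `p`-th root of unity `x ∈ K`; its
minimal polynomial is `Φ_p` of degree `p − 1 ≤ [K:ℚ] = 2`, so `p = 3`; then `x² + x + 1 = 0`,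
`(2x+1)² = −3`, and `d_K = −3` (the tree's `Quadratic.discr_eq_of_sq_eq_intCast`). [cite: Cox2013, §7.A (units of imaginary quadratic fields)] -/
theorem eq_three_and_discr_eq_of_dvd_unitsTorsionOrder {K : Type} [Field K] [NumberField K]
    (h2 : Module.finrank ℚ K = 2) {p : ℕ} (hp : p.Prime) (hp2 : p ≠ 2)
    (hdvd : p ∣ Units.torsionOrder K) : p = 3 ∧ NumberField.discr K = -3 := by
  haveI : Fact p.Prime := ⟨hp⟩
  -- an element of order `p` in the torsion subgroup (Cauchy)
  obtain ⟨g, hg⟩ := exists_prime_orderOf_dvd_card' (G := Units.torsion K) p hdvd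
  set u : (𝓞 K)ˣ := (g : (𝓞 K)ˣ) with hu
  have hou : orderOf u = p := by
    rw [hu, ← hg]
    exact Subgroup.orderOf_coe g
  set x : K := ((u : 𝓞 K) : K) with hx
  have hxpow : ∀ n : ℕ, x ^ n = (((u ^ n : (𝓞 K)ˣ) : 𝓞 K) : K) := by
    intro n; rw [hx]; push_cast; rfl
  have hxp : x ^ p = 1 := by
    rw [hxpow, ← hou, pow_orderOf_eq_one]; push_cast; rfl
  have hx1 : ∀ n : ℕ, 0 < n → n < p → x ^ n ≠ 1 := by
    intro n hn hnp hxn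
    have hun : u ^ n = 1 := by
      apply Units.ext
      apply RingOfIntegers.coe_injective
      have := hxpow n
      rw [hxn] at this
      push_cast at this ⊢
      exact this.symm
    have := orderOf_dvd_of_pow_eq_one hun
    rw [hou] at this
    exact absurd (Nat.le_of_dvd hn this) (not_le.mpr hnp)
  have hprim : IsPrimitiveRoot x p := by
    refine IsPrimitiveRoot.mk_of_lt x hp.pos hxp ?_
    intro n hn hnp
    exact hx1 n hn hnp
  -- degree: `p - 1 = deg Φ_p = deg minpoly_ℚ(x) ≤ [K:ℚ] = 2`
  have hmin : cyclotomic p ℚ = minpoly ℚ x := cyclotomic_eq_minpoly_rat hprim hp.pos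
  have hdeg : p - 1 ≤ 2 := by
    have h1 : (minpoly ℚ x).natDegree ≤ Module.finrank ℚ K := minpoly.natDegree_le x
    rw [← hmin, natDegree_cyclotomic, Nat.totient_prime hp, h2] at h1
    exact h1
  have hp3 : p = 3 := by
    have := hp.two_le
    omega
  refine ⟨hp3, ?_⟩
  subst hp3
  -- `x` is a primitive cube root of unity: `x² + x + 1 = 0`, so `(2x+1)² = -3`
  have hx3 : x ^ 3 = 1 := hxp
  have hxne : x ≠ 1 := by
    have := hx1 1 one_pos (by norm_num)
    simpa using this
  have hrel : x ^ 2 + x + 1 = 0 := by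
    have hfac : (x - 1) * (x ^ 2 + x + 1) = x ^ 3 - 1 := by ring
    have h0 : (x - 1) * (x ^ 2 + x + 1) = 0 := by rw [hfac, hx3, sub_self]
    rcases mul_eq_zero.mp h0 with h | h
    · exact absurd (sub_eq_zero.mp h) hxne
    · exact h
  have hθ : (2 * x + 1) ^ 2 = ((-3 : ℤ) : K) := by
    push_cast
    linear_combination 4 * hrel
  exact Quadratic.discr_eq_of_sq_eq_intCast h2 hθ (by simp)

/-- **For a Heegner field `K` of `N` and an odd prime `p ∣ N`: `p ∤ #(𝓞_K^×)_tors`.** By the previous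
lemma an odd `p ∣ w_K` is `3` with `d_K = −3`; but every prime dividing `N` splits in `K`, so it does not
divide `d_K` (`SatisfiesHeegnerHypothesis.not_dvd_discr`). In particular the binder `hμ : p ∤ #𝓞_K^×` of
lane B's datum theorems is AUTOMATIC at an additive (indeed any bad) prime `p` of `E` for every Heegner
field of the conductor. [cite: Cox2013, §7.A] [cite: Darmon2004, §3.9 (Heegner hypothesis: every ℓ ∣ N splits)] -/
theorem not_dvd_unitsTorsionOrder_of_heegner {K : Type} [Field K] [NumberField K]
    (hK : IsImaginaryQuadratic K) {N : ℕ} (hH : SatisfiesHeegnerHypothesis N K)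
    {p : ℕ} (hp : p.Prime) (hp2 : p ≠ 2) (hpN : p ∣ N) : ¬ p ∣ Units.torsionOrder K := by
  intro hdvd
  obtain ⟨rfl, hd⟩ := eq_three_and_discr_eq_of_dvd_unitsTorsionOrder hK.1 hp hp2 hdvd
  have hnd := Literature.SatisfiesHeegnerHypothesis.not_dvd_discr hK.1 hH hp hpN
  rw [hd] at hnd
  exact hnd (by norm_num)

/-! ### §23 The degenerate corner `L(E^{d_K},1) = 0`: the Heegner point is torsion and the index is `0` -/

/-- In an infinite abelian group the cyclic subgroup generated by a torsion element has infinite index,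
i.e. index `0` in Mathlib's convention (`#⟨P⟩ · [G:⟨P⟩] = #G = 0`). [folklore] -/
theorem index_zmultiples_eq_zero_of_isOfFinAddOrder {G : Type*} [AddCommGroup G] [Infinite G]
    {P : G} (hP : IsOfFinAddOrder P) : (AddSubgroup.zmultiples P).index = 0 := by
  have h := (AddSubgroup.zmultiples P).index_mul_card
  rw [Nat.card_zmultiples, Nat.card_eq_zero_of_infinite] at h
  have hpos : 0 < addOrderOf P := hP.addOrderOf_pos
  exact (mul_eq_zero.mp h).resolve_right hpos.ne'

/-- **`E(K)` is infinite for a rank-one `E/ℚ` and a quadratic `K`**: `rank E(K) = rank E(ℚ) + rank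
E^{(d_K)}(ℚ) ≥ 1` (Silverman AEC Ex. 10.16, tree theorem; Mordell–Weil for the finiteness; GZK `hGZK` for
`rank E(ℚ) = r_an = 1`). [cite: SilvermanAEC2009, Exercise 10.16 and Thm. VIII.6.7] -/
theorem infinite_point_baseChange_of_analyticRank_eq_one
    (hGZK : rank_eq_analyticRank_of_analyticRank_le_one)
    (W : WeierstrassCurve ℚ) [W.IsElliptic] (K : Type) [Field K] [NumberField K]
    (h2 : Module.finrank ℚ K = 2) (hr : W.analyticRank = 1) :
    Infinite (W.baseChange K).toAffine.Point := by
  haveI : (W.baseChange K).IsElliptic := KrizLi2019.isElliptic_baseChange' W K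
  haveI : Module.Finite ℤ (W.baseChange K).toAffine.Point := (W.baseChange K).module_finite_point_holds
  have hrQ : W.mordellWeilRank = 1 := by rw [(hGZK W (le_of_eq hr)).1, hr]
  have hrk := WeierstrassCurve.mordellWeilRank_baseChange_of_finrank_eq_two_of_finite W K h2
  apply WeierstrassCurve.infinite_point_of_rank_ne_zero
  rw [hrk, hrQ]; omega

/-- **If `L(E^{d_K},1) = 0` the Heegner point is torsion** (`ord_{s=1}L(E,s) = 1`): by modularity
`L′(E/K,1) = L′(E,1)·L(E^{d_K},1) = 0` (`lDerivEK_eq_deriv_mul`), and by Gross–Zagier `ĥ(P_K) = 0`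
(`lDerivEK_ne_zero_iff_not_isOfFinAddOrder`). [cite: GrossZagier1986, Thm. I.(6.3)] [cite: Gross1991, (1.1)] -/
theorem isOfFinAddOrder_heegnerPoint_of_twist_value_eq_zero
    (W : WeierstrassCurve ℚ) [W.IsElliptic] (N : ℕ) [NeZero N] (K : Type) [Field K] [NumberField K]
    (Dt : ModularParametrizationData W N) (H : HeegnerDatum N (NumberField.discr K)) (ι : K →+* ℂ)
    (P : (W.baseChange K).toAffine.Point)
    (hGZ : gross_zagier N W K) (hmod : hasEntireLFunction_rat)
    (hK : IsImaginaryQuadratic K) (hHN : SatisfiesHeegnerHypothesis N K)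
    (hP : WeierstrassCurve.Affine.Point.map ι.toRatAlgHom P = heegnerPointComplex Dt H)
    (hr : W.analyticRank = 1)
    (hLt : (W.quadraticTwist (NumberField.discr K : ℚ)).entireLFunction 1 = 0) :
    IsOfFinAddOrder P := by
  obtain ⟨h2, hKtc⟩ := hK
  have hL0 : W.entireLFunction 1 = 0 := entireLFunction_one_eq_zero_of_analyticRank_eq_one hr
  have hprod := KrizLi2019.lDerivEK_eq_deriv_mul W K hmod hL0
  have hLK : LDerivEK W K = 0 := by rw [hprod, hLt, mul_zero]
  have hPH : IsHeegnerPoint N W K P := ⟨Dt, H, ι, hP⟩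
  by_contra hPinf
  exact ((lDerivEK_ne_zero_iff_not_isOfFinAddOrder W N K hGZ ⟨h2, hKtc⟩ hHN hPH).mpr hPinf) hLK

/-! ### §24 ITEM 20498 ⟹ CRUX 19358 (and the rows statements), BY NAME -/

/-- **Crux `GordTwoRankOne` from the registered support item `AdjustedHeegnerIndexBoundTowerSurj`
(stmt-20498 = STEP L′) + PUBLISHED facts + the displayed rest** — the planner's `RepointCheck2`, landed:
Part 8's `gordTwoRankOne_of_adjustedIndexBound_of_rest` with `hL'` read off the item. PUBLISHED binders
`hGZ`, `hKo`, `hKatoT`, `hGZK`, `hmod`, `hnf`, `hmodP`, `hFH`, `hLLT` (Li–Liu–Tian 2024 on the CM rows);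
`hRest` = the crux DISPLAYED on the non-CM, non-tower-surjective rows (X3♯ / O8). Nothing booked; both
items OPEN. [cite: JetchevSkinnerWan2017, §7.4.1 (pp. 29–31)] [cite: LiLiuTian2024, Thm. 1.1 (i)]
[cite: Miller2011LMS, Def. 1.1] -/
theorem gordTwoRankOne_of_item_of_rest
    (hGZ : ∀ (N : ℕ) [NeZero N] (W : WeierstrassCurve ℚ) (K : Type) [Field K] [NumberField K],
      gross_zagier N W K)
    (hKo : ∀ (N : ℕ) [NeZero N] (W : WeierstrassCurve ℚ) (K : Type) [Field K] [NumberField K],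
      kolyvagin N W K)
    (hKatoT : Kato2004.rankZero_padicValNat_sha_add_padicValNat_tamagawa_le_of_additive_potGood_of_imageContainsSL2)
    (hGZK : rank_eq_analyticRank_of_analyticRank_le_one) (hmod : hasEntireLFunction_rat)
    (hnf : exists_isNewformOf) (hmodP : nonempty_modularParametrizationData)
    (hFH : friedbergHoffstein_exists_heegnerField_split_twist_ne_zero)
    (hLLT : LiLiuTian2024.thm11_bsdp_of_cm_rank_one)
    (hL' : AdjustedHeegnerIndexBoundTowerSurj)
    (hRest : ∀ (W : WeierstrassCurve ℚ) [W.IsElliptic] [W.IsGloballyMinimal] (p : ℕ) [Fact p.Prime],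
      W.analyticRank = 1 → N10.CellGordTwo W p → ¬ W.HasCM →
      ¬ (∀ n : ℕ, W.HasSurjectiveModNGaloisRep (p ^ n : ℕ)) → Typed.MissingLowerBoundAt W p) :
    GordTwoRankOne :=
  gordTwoRankOne_of_adjustedIndexBound_of_rest hGZ hKo hKatoT hGZK hmod hnf hmodP hFH hLLT
    (fun W _ _ p _ N _ K _ _ Dt H ι P Wd _ _ Cd ↦ hL' W p N K Dt H ι P Wd Cd) hRest

/-- **The (ii)-rows statement BY NAME**: item 20498 + PUBLISHED facts ⟹ the crux's conclusion
`Typed.MissingLowerBoundAt W p` on EVERY rank-one tower-surjective pair of cell (G-ord, `e = 2`) (Part 8's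
class-level theorem with `hL'` read off the item). Nothing booked. [cite: JetchevSkinnerWan2017, §7.4.1 (pp. 29–31)]
[cite: Kato2004Asterisque, Thm. 14.5 (3) (p. 236)] [cite: Miller2011LMS, Def. 1.1] -/
theorem cellGordTwo_missingLowerBoundAt_rankOne_of_towerSurj_of_item
    (hGZ : ∀ (N : ℕ) [NeZero N] (W : WeierstrassCurve ℚ) (K : Type) [Field K] [NumberField K],
      gross_zagier N W K)
    (hKo : ∀ (N : ℕ) [NeZero N] (W : WeierstrassCurve ℚ) (K : Type) [Field K] [NumberField K],
      kolyvagin N W K)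
    (hKatoT : Kato2004.rankZero_padicValNat_sha_add_padicValNat_tamagawa_le_of_additive_potGood_of_imageContainsSL2)
    (hGZK : rank_eq_analyticRank_of_analyticRank_le_one) (hmod : hasEntireLFunction_rat)
    (hnf : exists_isNewformOf) (hmodP : nonempty_modularParametrizationData)
    (hFH : friedbergHoffstein_exists_heegnerField_split_twist_ne_zero)
    (hL' : AdjustedHeegnerIndexBoundTowerSurj) :
    ∀ (W : WeierstrassCurve ℚ) [W.IsElliptic] [W.IsGloballyMinimal] (p : ℕ) [Fact p.Prime],
      W.analyticRank = 1 → N10.CellGordTwo W p →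
      (∀ n : ℕ, W.HasSurjectiveModNGaloisRep (p ^ n : ℕ)) → Typed.MissingLowerBoundAt W p :=
  cellGordTwo_missingLowerBoundAt_rankOne_of_towerSurj_of_adjustedIndexBound hGZ hKo hKatoT hGZK hmod hnf
    hmodP hFH (fun W _ _ p _ N _ K _ _ Dt H ι P Wd _ _ Cd ↦ hL' W p N K Dt H ι P Wd Cd)

/-! ### §25 CRUX 19358 ⟹ ITEM 20498 (no free lunch, BY NAME) -/

/-- **The crux implies the registered support item (no free lunch, BY NAME).** `GordTwoRankOne` (item
19358, as a HYPOTHESIS) + the rank-zero LOWER half `Typed.MissingLowerBoundAt Wd p` at every globally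
minimal model of the twist by a Heegner field `K` of the conductor with `L(E^{d_K},1) ≠ 0` (crux 19357's
conclusion there) + PUBLISHED `hGZ`, `hKo`, `hGZK`, `hmod` ⟹ `AdjustedHeegnerIndexBoundTowerSurj` (item
20498). At a field with `L(E^{d_K},1) = 0` the Heegner point is torsion in the infinite group `E(K)`, so the
index is `0` and the inequality is trivial (§23); elsewhere it is Part 9's
`adjustedIndexBound_of_gordTwoRankOne_of_twistLower`, the binder `p ∤ #𝓞_K^×` being automatic (§22,
`p ∣ N` additive). Hence, modulo PUBLISHED facts, 19358 ∧ 19357-at-the-twists ⟹ 20498 and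
20498 ∧ LLT ∧ rest ⟹ 19358. Nothing booked; an implication between OPEN statements.
[cite: JetchevSkinnerWan2017, §7.4.1 (pp. 29–31)] [cite: GrossZagier1986, Thm. I.(6.3) and V.§2]
[cite: Miller2011LMS, Def. 1.1] -/
theorem adjustedHeegnerIndexBoundTowerSurj_of_gordTwoRankOne_of_twistLower
    (hcrux : GordTwoRankOne)
    (hGZ : ∀ (N : ℕ) [NeZero N] (W : WeierstrassCurve ℚ) (K : Type) [Field K] [NumberField K],
      gross_zagier N W K)
    (hKo : ∀ (N : ℕ) [NeZero N] (W : WeierstrassCurve ℚ) (K : Type) [Field K] [NumberField K],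
      kolyvagin N W K)
    (hGZK : rank_eq_analyticRank_of_analyticRank_le_one) (hmod : hasEntireLFunction_rat)
    (hTwL : ∀ (W : WeierstrassCurve ℚ) [W.IsElliptic] [W.IsGloballyMinimal] (p : ℕ) [Fact p.Prime]
      (K : Type) [Field K] [NumberField K]
      (Wd : WeierstrassCurve ℚ) [Wd.IsElliptic] [Wd.IsGloballyMinimal] (Cd : VariableChange ℚ),
      W.analyticRank = 1 → N10.CellGordTwo W p → (∀ n : ℕ, W.HasSurjectiveModNGaloisRep (p ^ n : ℕ)) →
      IsImaginaryQuadratic K → SatisfiesHeegnerHypothesis (W.conductorNorm ℤ) K →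
      (W.quadraticTwist (NumberField.discr K : ℚ)).entireLFunction 1 ≠ 0 →
      Cd • W.quadraticTwist (NumberField.discr K : ℚ) = Wd → Typed.MissingLowerBoundAt Wd p) :
    AdjustedHeegnerIndexBoundTowerSurj := by
  intro W _ _ p _ N _ K _ _ hdK Dt H ι P Wd _ _ Cd hr hcell hsurj hN hK hHN hP hWd _hfin
  -- the item's `[DecidableEq K]` binder vs. the classical instance of lane B's files (a subsingleton)
  obtain rfl : hdK = (fun a b ↦ Classical.propDecidable (a = b)) := Subsingleton.elim _ _
  have hp : p.Prime := Fact.out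
  have hp2 : p ≠ 2 := hcell.1
  have hadd : Addv W p := hcell.2.1
  -- `p ∣ N` (additive), hence `p ∤ #𝓞_K^×` for the Heegner field `K`
  have hpN : p ∣ N := by
    rw [← hN]; exact (W.dvd_conductorNorm_iff_not_hasGoodReductionAtPrime p).mpr hadd.1
  have hμ : ¬ p ∣ Units.torsionOrder K := not_dvd_unitsTorsionOrder_of_heegner hK hHN hp hp2 hpN
  by_cases hLt : (W.quadraticTwist (NumberField.discr K : ℚ)).entireLFunction 1 = 0
  · -- degenerate corner: the Heegner point is torsion, the index is `0`
    have htor : IsOfFinAddOrder P :=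
      isOfFinAddOrder_heegnerPoint_of_twist_value_eq_zero W N K Dt H ι P (hGZ N W K) hmod hK hHN hP hr hLt
    haveI : Infinite (W.baseChange K).toAffine.Point :=
      infinite_point_baseChange_of_analyticRank_eq_one hGZK W K hK.1 hr
    rw [index_zmultiples_eq_zero_of_isOfFinAddOrder htor]
    have e3 : (0 : ℤ) ≤ padicValRat p (Dt.c : ℚ) := by rw [padicValRat.of_int]; positivity
    have e4 : (0 : ℤ) ≤ (padicValNat p (W.baseChange K).shaOrder : ℤ) + padicValNat p W.tamagawaProduct +
        padicValNat p Wd.tamagawaProduct := by positivity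
    simp only [padicValNat_zero_right, Nat.cast_zero, mul_zero]
    linarith
  · -- generic case: Part 9
    have hSH : SatisfiesHeegnerHypothesis (W.conductorNorm ℤ) K := by rw [hN]; exact hHN
    exact adjustedIndexBound_of_gordTwoRankOne_of_twistLower hcrux W p N K Dt H ι P (hGZ N W K)
      (hKo N W K) hGZK hmod hr hcell hN hK hHN hP hμ hLt Wd Cd hWd
      (hTwL W p K Wd Cd hr hcell hsurj hK hSH hLt hWd)

end Summit.BirchSwinnertonDyer.BirchSwinnertonDyer.Theorems.AdditiveBranchIMCGordTwoRankOne.HeegnerKolyvagin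

end
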